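import Summits.QuantumFields.YangMills.Theorems.IR.EsPolymerDecoupling
import Literature.Probability.LatticeModels.LocalPerturbationPolymerGas
import Literature.MathematicalPhysics.QuantumFieldTheory.TorusPlaquetteNeighbours

/-!
# Crux `IR` (item stmt-QuantumFields-19354) — line «es-polymer-decoupling», rung `stub_esRung`: CELLS OF THE MESH-1 GRID,
their link supports, the cell Boltzmann factors, and finite-range independence under product Haar

Helper module for item `stmt-QuantumFields-19354` (`--supports … --as helper`; it closes nothing; lead prover
ym-ir-line-mxc-p1 g2, R366 pooled task «es-polymer rung»).  Vocabulary and lemmas for the Edwards–Sokal / Kandel–Domany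
cell-deletion construction of a decoupling–polymer representation `DPR ρ β S 1 p` (`Theorems/IR/EsPolymerDefs.lean`) at strong
coupling: at mesh `1` the grid is `w i j = j` (`isGrid_unit`), cells are sites (`cellEquiv`), the links of a cell are the
four links based at its site (`torusCellEdges_unit`), the cell Boltzmann factor `cellWeight ρ β c = exp(−β ∑_{plaquettes based at
c}(n − Re tr ρ U_p))` reads only the links of those plaquettes (`cellLinks c`, `dependsOn_cellWeight`) and is measurable for
EVERY compact group (no second countability: the holonomy is pushed through `ρ` into matrices, `measurable_cellWeight`), its
product over the cells is `exp(−β S_W)` (`prod_cellWeight`), and under product Haar measure the link σ-algebras of two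
families of cells at mutual cell-distance `≥ 2` are independent (`indep_cellSigma_of_two_le`, the tree's
`IsLocalPerturbation.indep_of_iIndep`; `cellDist_le_one_of_not_disjoint`: cells sharing a link are at distance `≤ 1`), whence
the real factorisation lemma `integral_mul_eq_of_cells` for cell-local integrands.

HONEST FRAMING: lattice bookkeeping for a strong-coupling rung of a conditional line; no claim about weak coupling or Clay.
-/

set_option autoImplicit false

noncomputable section

open MeasureTheory ProbabilityTheory Finset Function
open Literature.MathematicalPhysics.QuantumFieldTheory
open Literature.Probability.LatticeModels (Touches ShareVertex IsLocalPerturbation.indep_of_iIndep)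
open Summit.QuantumFields.YangMills.Cruxes.IR.Tempered (cellEdges)

namespace Summit.QuantumFields.YangMills.Cruxes.IR.EsPolymer

/-! ## §1 The mesh-1 grid: cells are sites -/

section Grid

variable {N : ℕ} [NeZero N]

/-- The mesh-1 grid `w i j = j` on the torus of side `N` (with `N` cells per direction) is a grid. -/
theorem isGrid_unit : IsGrid N 1 N (fun _ j => j) :=
  ⟨Nat.pos_of_ne_zero (NeZero.ne N), fun _ => rfl, fun _ j => ⟨by push_cast; omega, by push_cast; omega⟩,
    fun _ _ => by push_cast; ring⟩

/-- Cells of the mesh-1 grid are the sites of the torus. -/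
def cellEquiv : Cell N ≃ Site 4 N := Equiv.piCongrRight fun _ => (ZMod.finEquiv N).toEquiv

/-- `((c i).val : ZMod N) = cellEquiv c i`. -/
theorem natCast_val_eq_cellEquiv (c : Cell N) (i : Fin 4) : ((c i : ℕ) : ZMod N) = cellEquiv c i := by
  obtain ⟨n, rfl⟩ : ∃ n, N = n + 1 := Nat.exists_eq_succ_of_ne_zero (NeZero.ne N)
  exact ZMod.natCast_zmod_val (ZMod.finEquiv (n + 1) (c i))

/-- At mesh `1` the links of a cell are the four links based at its site. -/
theorem torusCellEdges_unit (c : Cell N) :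
    torusCellEdges N N (fun _ j => j) c = Finset.univ.image fun i : Fin 4 => (cellEquiv c, i) := by
  have hproj : Literature.Probability.LatticeModels.Torus.proj N (fun j => ((c j).val : ℤ)) = cellEquiv c := by
    funext j
    simp [Literature.Probability.LatticeModels.Torus.proj, natCast_val_eq_cellEquiv]
  ext e
  simp only [torusCellEdges, cellEdges, Finset.mem_image, Finset.mem_product, Fintype.mem_piFinset, Finset.mem_Ico,
    Finset.mem_univ, and_true, true_and]
  constructor
  · rintro ⟨⟨y, i⟩, hy, rfl⟩
    have hyc : y = fun j => ((c j).val : ℤ) := funext fun j => le_antisymm (Int.lt_add_one_iff.1 (hy j).2) (hy j).1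
    subst hyc
    exact ⟨i, by rw [← hproj]; rfl⟩
  · rintro ⟨i, rfl⟩
    exact ⟨((fun j => ((c j).val : ℤ), i) : Literature.MathematicalPhysics.QuantumLattice.ZdEdge 4),
      fun j => ⟨le_rfl, Int.lt_succ _⟩, by rw [← hproj]; rfl⟩

open Fin.CommRing in
/-- The cell distance is the periodic sup-distance of the sites. -/
theorem cellDist_eq_torusNorm (c c' : Cell N) : cellDist c c' = torusNorm (cellEquiv c - cellEquiv c') := by
  unfold cellDist torusNorm
  congr 1; funext i
  have h : (cellEquiv c - cellEquiv c') i = (ZMod.finEquiv N) (c i - c' i) := by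
    simp [cellEquiv, map_sub]
  rw [h, cycAbs, ZMod.valMinAbs_natAbs_eq_min]
  obtain ⟨n, rfl⟩ : ∃ n, N = n + 1 := Nat.exists_eq_succ_of_ne_zero (NeZero.ne N)
  rfl

end Grid

/-! ## §2 The links read by a cell factor, and when two cells share one -/

section Links

variable {N : ℕ} [NeZero N]

/-- The links of the six plaquettes based at the cell's site: the support of the cell Boltzmann factor. -/
def cellLinks (c : Cell N) : Finset (Edge 4 N) :=
  (Finset.univ : Finset {p : Fin 4 × Fin 4 // p.1 < p.2}).biUnion fun ij => plaqEdgesT (cellEquiv c, ij)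

/-- The links based at the cell's site belong to `cellLinks`. -/
theorem base_mem_cellLinks (c : Cell N) (i : Fin 4) : (cellEquiv c, i) ∈ cellLinks c := by
  rw [cellLinks, Finset.mem_biUnion]
  obtain ⟨j, hj⟩ : ∃ j : Fin 4, j ≠ i := ⟨i + 1, by simp⟩
  rcases lt_or_gt_of_ne hj with h | h
  · exact ⟨⟨(j, i), h⟩, Finset.mem_univ _, by simp [plaqEdgesT]⟩
  · exact ⟨⟨(i, j), h⟩, Finset.mem_univ _, by simp [plaqEdgesT]⟩

/-- `cellLinks` is nonempty. -/
theorem cellLinks_nonempty (c : Cell N) : (cellLinks c).Nonempty := ⟨_, base_mem_cellLinks c 0⟩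

/-- The base site of a link of `cellLinks c` is the cell's site or a forward neighbour of it. -/
theorem exists_eq_add_single_of_mem_cellLinks {c : Cell N} {e : Edge 4 N} (he : e ∈ cellLinks c) :
    e.1 = cellEquiv c ∨ ∃ k : Fin 4, e.1 = cellEquiv c + Pi.single k 1 := by
  rw [cellLinks, Finset.mem_biUnion] at he
  obtain ⟨ij, -, h⟩ := he
  simp only [plaqEdgesT, Finset.mem_insert, Finset.mem_singleton] at h
  rcases h with rfl | rfl | rfl | rfl
  · exact Or.inl rfl
  · exact Or.inr ⟨ij.1.1, rfl⟩
  · exact Or.inr ⟨ij.1.2, rfl⟩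
  · exact Or.inl rfl

omit [NeZero N] in
/-- `‖e_a − e_b‖_{∞,N} ≤ 1` on the torus (coordinates in `{0, ±1}`). -/
theorem torusNorm_single_sub_single_le (a b : Fin 4) :
    torusNorm ((Pi.single a (1 : ZMod N) : Site 4 N) - Pi.single b 1) ≤ 1 := by
  refine Finset.sup_le fun i _ => ?_
  simp only [Pi.sub_apply, Pi.single_apply]
  split_ifs <;> simp [natAbs_valMinAbs_one_le_one]

omit [NeZero N] in
/-- `‖e_a‖_{∞,N} ≤ 1`. -/
theorem torusNorm_single_le (a : Fin 4) : torusNorm (Pi.single a (1 : ZMod N) : Site 4 N) ≤ 1 := by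
  refine Finset.sup_le fun i _ => ?_
  simp only [Pi.single_apply]
  split_ifs <;> simp [natAbs_valMinAbs_one_le_one]

/-- **Cells sharing a link are at cell-distance `≤ 1`.** -/
theorem cellDist_le_one_of_not_disjoint {c c' : Cell N} (h : ¬ Disjoint (cellLinks c) (cellLinks c')) :
    cellDist c c' ≤ 1 := by
  rw [Finset.not_disjoint_iff] at h
  obtain ⟨e, he, he'⟩ := h
  rw [cellDist_eq_torusNorm]
  have key : ∀ (x x' : Site 4 N) (v v' : Site 4 N), x + v = x' + v' → torusNorm v ≤ 1 → torusNorm v' ≤ 1 →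
      torusNorm (v' - v) ≤ 1 → torusNorm (x - x') ≤ 1 := by
    intro x x' v v' h _ _ hvv'
    have : x - x' = v' - v := by rw [sub_eq_sub_iff_add_eq_add, h]; abel
    rw [this]; exact hvv'
  rcases exists_eq_add_single_of_mem_cellLinks he with h1 | ⟨k, h1⟩ <;>
    rcases exists_eq_add_single_of_mem_cellLinks he' with h2 | ⟨k', h2⟩
  · rw [← h1, h2, sub_self, torusNorm_zero]; exact zero_le_one
  · refine key (cellEquiv c) (cellEquiv c') 0 (Pi.single k' 1) (by rw [add_zero, ← h1, h2]) (by simp)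
      (torusNorm_single_le k') ?_
    rw [sub_zero]; exact torusNorm_single_le k'
  · refine key (cellEquiv c) (cellEquiv c') (Pi.single k 1) 0 (by rw [add_zero, ← h1, h2]) (torusNorm_single_le k)
      (by simp) ?_
    rw [zero_sub, torusNorm_neg]; exact torusNorm_single_le k
  · refine key (cellEquiv c) (cellEquiv c') (Pi.single k 1) (Pi.single k' 1) (by rw [← h1, h2]) (torusNorm_single_le k)
      (torusNorm_single_le k') (torusNorm_single_sub_single_le k' k)

/-- Families of cells at mutual cell-distance `≥ 2` do not touch for «sharing a link». -/
theorem not_touches_of_two_le {K₁ K₂ : Finset (Cell N)} (h : ∀ c ∈ K₁, ∀ c' ∈ K₂, 2 ≤ cellDist c c') :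
    ¬ Touches (ShareVertex cellLinks) K₁ K₂ := by
  rintro ⟨c, hc, c', hc', hcc'⟩
  have h2 := h c hc c' hc'
  rcases hcc' with rfl | hsv
  · have : cellDist c c = 0 := by simp [cellDist, cycAbs]
    omega
  · have h1 := cellDist_le_one_of_not_disjoint (c := c) (c' := c')
      (fun hd => by rw [ShareVertex, Finset.disjoint_iff_inter_eq_empty.1 hd] at hsv; simp at hsv)
    omega

end Links


/-! ## §3 The cell Boltzmann factors -/

section Weight

variable {N : ℕ} [NeZero N] {G : Type} [Group G] [TopologicalSpace G] [IsTopologicalGroup G] [CompactSpace G]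
  [MeasurableSpace G] [BorelSpace G] {n : ℕ} (ρ : G →* Matrix (Fin n) (Fin n) ℂ) (β : ℝ)

/-- The **cell Boltzmann factor** of the mesh-1 grid: `W_c(U) = exp(−β ∑_{plaquettes based at the site of c}(n − Re tr ρ U_p))`. -/
def cellWeight (c : Cell N) (U : GaugeConfig 4 N G) : ℝ :=
  Real.exp (-(β * ∑ ij : {p : Fin 4 × Fin 4 // p.1 < p.2},
    ((n : ℝ) - (ρ (plaquetteHolonomy U (cellEquiv c) ij.1.1 ij.1.2)).trace.re)))

omit [TopologicalSpace G] [IsTopologicalGroup G] [CompactSpace G] [MeasurableSpace G] [BorelSpace G] in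
/-- `W_c > 0`. -/
theorem cellWeight_pos (c : Cell N) (U : GaugeConfig 4 N G) : 0 < cellWeight ρ β c U := Real.exp_pos _

omit [TopologicalSpace G] [IsTopologicalGroup G] [CompactSpace G] [MeasurableSpace G] [BorelSpace G] in
/-- **`∏_c W_c = exp(−β S_W)`**: the Wilson action is the sum over sites of the costs of the plaquettes based there. -/
theorem prod_cellWeight (U : GaugeConfig 4 N G) : ∏ c, cellWeight ρ β c U = Real.exp (-β * wilsonAction ρ U) := by
  unfold cellWeight wilsonAction
  rw [← Real.exp_sum]
  congr 1
  rw [Finset.sum_neg_distrib, ← Finset.mul_sum, neg_mul, Fintype.sum_prod_type, ← cellEquiv.sum_comp]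

omit [TopologicalSpace G] [IsTopologicalGroup G] [CompactSpace G] [MeasurableSpace G] [BorelSpace G] in
/-- `W_c` reads only the links of the plaquettes based at the cell's site. -/
theorem dependsOn_cellWeight (c : Cell N) : DependsOn (cellWeight ρ β c) (↑(cellLinks c) : Set (Edge 4 N)) := by
  intro U V h
  have hp : ∀ ij : {p : Fin 4 × Fin 4 // p.1 < p.2},
      plaquetteHolonomy U (cellEquiv c) ij.1.1 ij.1.2 = plaquetteHolonomy V (cellEquiv c) ij.1.1 ij.1.2 := fun ij =>
    dependsOn_plaquetteHolonomy (cellEquiv c, ij) fun e he =>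
      h e (Finset.mem_coe.2 (Finset.mem_biUnion.2 ⟨ij, Finset.mem_univ _, Finset.mem_coe.1 he⟩))
  simp only [cellWeight, hp]

omit [NeZero N] [CompactSpace G] in
/-- `U ↦ Re tr ρ(U_p)` is measurable for EVERY compact (indeed every topological) group: push the holonomy through `ρ`
into the second-countable matrix algebra. -/
theorem measurable_trace_re_plaquetteHolonomy (hρ : Continuous ρ) (x : Site 4 N) (i j : Fin 4) :
    Measurable fun U : GaugeConfig 4 N G => (ρ (plaquetteHolonomy U x i j)).trace.re := by
  letI : MeasurableSpace (Matrix (Fin n) (Fin n) ℂ) := borel _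
  haveI : BorelSpace (Matrix (Fin n) (Fin n) ℂ) := ⟨rfl⟩
  haveI : SecondCountableTopology (Matrix (Fin n) (Fin n) ℂ) :=
    inferInstanceAs (SecondCountableTopology (Fin n → Fin n → ℂ))
  have hρm : Measurable ρ := hρ.measurable
  have hev : ∀ e : Edge 4 N, Measurable fun U : GaugeConfig 4 N G => ρ (U e) := fun e =>
    hρm.comp (measurable_pi_apply e)
  have hinv : ∀ e : Edge 4 N, Measurable fun U : GaugeConfig 4 N G => ρ ((U e)⁻¹) := fun e =>
    hρm.comp (measurable_pi_apply e).inv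
  have htr : Measurable fun M : Matrix (Fin n) (Fin n) ℂ => (M.trace).re :=
    (Complex.continuous_re.comp (continuous_id.matrix_trace)).measurable
  have key : Measurable fun U : GaugeConfig 4 N G =>
      ((ρ (U (x, i)) * ρ (U (x.shift i, j)) * ρ ((U (x.shift j, i))⁻¹) * ρ ((U (x, j))⁻¹)).trace).re :=
    htr.comp ((((hev _).mul (hev _)).mul (hinv _)).mul (hinv _))
  convert key using 1
  funext U
  simp only [plaquetteHolonomy, map_mul]

omit [CompactSpace G] in
/-- `W_c` is measurable (any compact group; continuous `ρ`). -/
theorem measurable_cellWeight (hρ : Continuous ρ) (c : Cell N) : Measurable (cellWeight ρ β c) := by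
  unfold cellWeight
  refine (((Finset.measurable_sum _ fun ij _ => measurable_const.sub
    (measurable_trace_re_plaquetteHolonomy ρ hρ _ _ _)).const_mul β).neg).exp

omit [TopologicalSpace G] [IsTopologicalGroup G] [CompactSpace G] [MeasurableSpace G] [BorelSpace G] in
/-- **Two-sided bounds**: `exp(−D) ≤ W_c ≤ exp(D)` with `D = |β| · #planes · (n + B)`, `B` a bound on `|Re tr ρ|`. -/
theorem cellWeight_bounds {B : ℝ} (hB : ∀ g : G, |(ρ g).trace.re| ≤ B) (c : Cell N) (U : GaugeConfig 4 N G) :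
    Real.exp (-(|β| * (Fintype.card {p : Fin 4 × Fin 4 // p.1 < p.2} * ((n : ℝ) + B)))) ≤ cellWeight ρ β c U ∧
      cellWeight ρ β c U ≤ Real.exp (|β| * (Fintype.card {p : Fin 4 × Fin 4 // p.1 < p.2} * ((n : ℝ) + B))) := by
  have hsum : |∑ ij : {p : Fin 4 × Fin 4 // p.1 < p.2},
      ((n : ℝ) - (ρ (plaquetteHolonomy U (cellEquiv c) ij.1.1 ij.1.2)).trace.re)| ≤
      Fintype.card {p : Fin 4 × Fin 4 // p.1 < p.2} * ((n : ℝ) + B) := by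
    refine (Finset.abs_sum_le_sum_abs _ _).trans ?_
    calc ∑ ij : {p : Fin 4 × Fin 4 // p.1 < p.2}, |((n : ℝ) - (ρ (plaquetteHolonomy U (cellEquiv c) ij.1.1 ij.1.2)).trace.re)|
        ≤ ∑ _ij : {p : Fin 4 × Fin 4 // p.1 < p.2}, ((n : ℝ) + B) := Finset.sum_le_sum fun ij _ =>
          (abs_sub _ _).trans (add_le_add (le_of_eq (Nat.abs_cast n)) (hB _))
      _ = _ := by rw [Finset.sum_const, Finset.card_univ, nsmul_eq_mul]
  have hprod : |β * ∑ ij : {p : Fin 4 × Fin 4 // p.1 < p.2},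
      ((n : ℝ) - (ρ (plaquetteHolonomy U (cellEquiv c) ij.1.1 ij.1.2)).trace.re)| ≤
      |β| * (Fintype.card {p : Fin 4 × Fin 4 // p.1 < p.2} * ((n : ℝ) + B)) := by
    rw [abs_mul]; exact mul_le_mul_of_nonneg_left hsum (abs_nonneg _)
  obtain ⟨h1, h2⟩ := abs_le.1 hprod
  unfold cellWeight
  exact ⟨Real.exp_le_exp.2 (by linarith), Real.exp_le_exp.2 (by linarith)⟩

end Weight

/-! ## §4 Finite-range independence under product Haar, and the factorisation lemma -/

section Indep

variable {N : ℕ} [NeZero N] {G : Type} [MeasurableSpace G]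

/-- The σ-algebra of the links of a cell set. -/
theorem cylinderEvents_cellLinks_eq (c : Cell N) :
    cylinderEvents (X := fun _ : Edge 4 N => G) (↑(cellLinks c) : Set (Edge 4 N)) =
      ⨆ a ∈ cellLinks c, MeasurableSpace.comap (fun U : GaugeConfig 4 N G => U a) inferInstance := by
  simp only [cylinderEvents, Finset.mem_coe]

/-- A function reading only the links of the cells of `K` is measurable for their σ-algebra. -/
theorem measurable_iSup_of_dependsOn {K : Finset (Cell N)} {α : Type*} [MeasurableSpace α]
    {f : GaugeConfig 4 N G → α} (hfm : Measurable f)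
    (hdep : DependsOn f (↑(K.biUnion cellLinks) : Set (Edge 4 N))) :
    Measurable[⨆ c ∈ K, cylinderEvents (X := fun _ : Edge 4 N => G) (↑(cellLinks c) : Set (Edge 4 N))] f := by
  have h1 := hfm.measurable_cylinderEvents_of_dependsOn hdep
  refine h1.mono ?_ le_rfl
  refine iSup₂_le fun a ha => ?_
  obtain ⟨c, hc, hac⟩ := Finset.mem_biUnion.1 (Finset.mem_coe.1 ha)
  calc MeasurableSpace.comap (fun U : GaugeConfig 4 N G => U a) inferInstance
      ≤ cylinderEvents (X := fun _ : Edge 4 N => G) (↑(cellLinks c) : Set (Edge 4 N)) :=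
        le_iSup₂ (f := fun i (_ : i ∈ (↑(cellLinks c) : Set (Edge 4 N))) =>
          MeasurableSpace.comap (fun U : GaugeConfig 4 N G => U i) inferInstance) a (Finset.mem_coe.2 hac)
    _ ≤ ⨆ c ∈ K, cylinderEvents (X := fun _ : Edge 4 N => G) (↑(cellLinks c) : Set (Edge 4 N)) :=
        le_iSup₂ (f := fun c (_ : c ∈ K) => cylinderEvents (X := fun _ : Edge 4 N => G) (↑(cellLinks c) : Set (Edge 4 N))) c hc

variable (m₀ : Measure G) [IsProbabilityMeasure m₀]

/-- **Finite-range independence**: under the product reference measure the link σ-algebras of two families of cells at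
mutual cell-distance `≥ 2` are independent (they read disjoint sets of links). -/
theorem indep_cellSigma_of_two_le {K₁ K₂ : Finset (Cell N)} (h : ∀ c ∈ K₁, ∀ c' ∈ K₂, 2 ≤ cellDist c c') :
    Indep (⨆ c ∈ K₁, cylinderEvents (X := fun _ : Edge 4 N => G) (↑(cellLinks c) : Set (Edge 4 N)))
      (⨆ c ∈ K₂, cylinderEvents (X := fun _ : Edge 4 N => G) (↑(cellLinks c) : Set (Edge 4 N)))
      (Measure.pi fun _ : Edge 4 N => m₀) := by
  classical
  have hind : iIndep (fun a : Edge 4 N => MeasurableSpace.comap (fun U : GaugeConfig 4 N G => U a) inferInstance)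
      (Measure.pi fun _ : Edge 4 N => m₀) := by
    rw [← iIndepFun_iff_iIndep]
    exact iIndepFun_pi (X := fun (_ : Edge 4 N) (u : G) => u) fun _ => aemeasurable_id
  have h := IsLocalPerturbation.indep_of_iIndep (μ := Measure.pi fun _ : Edge 4 N => m₀)
    (fun a => (measurable_pi_apply a).comap_le) hind cellLinks cellLinks_nonempty K₁ K₂ (not_touches_of_two_le h)
  simpa only [cylinderEvents_cellLinks_eq] using h

/-- **Factorisation of cell-local integrands**: for real `X`, `Y` measurable for the link σ-algebras of cell families at
mutual distance `≥ 2` and bounded, `∫ X·Y = ∫ X · ∫ Y` under product Haar. -/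
theorem integral_mul_eq_of_cells {K₁ K₂ : Finset (Cell N)} (h : ∀ c ∈ K₁, ∀ c' ∈ K₂, 2 ≤ cellDist c c')
    {X Y : GaugeConfig 4 N G → ℝ}
    (hX : Measurable[⨆ c ∈ K₁, cylinderEvents (X := fun _ : Edge 4 N => G) (↑(cellLinks c) : Set (Edge 4 N))] X)
    (hY : Measurable[⨆ c ∈ K₂, cylinderEvents (X := fun _ : Edge 4 N => G) (↑(cellLinks c) : Set (Edge 4 N))] Y) :
    ∫ U, X U * Y U ∂(Measure.pi fun _ : Edge 4 N => m₀) =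
      (∫ U, X U ∂(Measure.pi fun _ : Edge 4 N => m₀)) * ∫ U, Y U ∂(Measure.pi fun _ : Edge 4 N => m₀) := by
  have hle : ∀ K : Finset (Cell N),
      (⨆ c ∈ K, cylinderEvents (X := fun _ : Edge 4 N => G) (↑(cellLinks c) : Set (Edge 4 N))) ≤ MeasurableSpace.pi :=
    fun K => iSup₂_le fun c _ => cylinderEvents_le_pi
  have hXY : IndepFun X Y (Measure.pi fun _ : Edge 4 N => m₀) := by
    rw [IndepFun_iff_Indep]
    exact indep_of_indep_of_le_right (indep_of_indep_of_le_left (indep_cellSigma_of_two_le m₀ h) hX.comap_le)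
      hY.comap_le
  exact hXY.integral_mul_eq_mul_integral (hX.mono (hle K₁) le_rfl).aestronglyMeasurable
    (hY.mono (hle K₂) le_rfl).aestronglyMeasurable

end Indep

end Summit.QuantumFields.YangMills.Cruxes.IR.EsPolymer

end
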